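import Summits.QuantumFields.YangMills.Theorems.BalabanUVNodesN26AtBetaOfRecord11B13Layers
import Literature.MathematicalPhysics.QuantumFieldTheory.Balaban1983to89.Node00.Record12CarriersB13

/-!
# DAG node N26 — B4 «β-continuity» AT THE STAGE-12 RECORD FROM THE RECORD'S OWN RUN-INDEXED [B13] LAYERS: the (D4) wall along RUN SEQUENCES through
# `lam13 : B12.RunParams → Node00.ResidB13 θ₃` (one layer per run, as the seven-pin record `Node00.IsRecordOfRecord₁₂CB10YZWB8B12B13` carries them), N10's OWN
# leaf at the record = the wall's Lemma-3 leaf for the record's OWN steps, and crux K2′'s registered stub `D4AtSlopeOfD1Record12` AT θ from that list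

Cell `pub-ymgap`, YM-PLAN Track A (HUMAN RULING D-0062), seat `pub-ymgap-dag-n26-c` gen 3 (R134 acceleration seat, s2; harness re-seat; director-ym row «the (D4)-chain
INSTANCE `Gaps.BetaContFromD4Chain.betaContH_of_chainTFac190H` for the datum of record at `betaOfRecord₁₁` (crew D4 files by name)»).  Over the row-(D4) owner's
`BalabanUVNodesN26AtBetaOfRecord11B13Layers` (b2b-balaban-beta-an4 g124, p468083: the (D4)-chain at the record's split AS AN OBJECT `chainTFac190H_ofB13Layers` over NODE 00's
[B13] layer sequences `lam k v : ℕ → ResidB13 θ.toStage3Params` + N10's leaf per layer, θ-keyed at Stage 11, and its Stage-12 faces at the view) and node00-def-B13's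
`Node00.Record12CarriersB13` (the seven-pin Stage-12 record).  DEDUP of record (pub-ymgap bus, an4 g124 → dag-n26-c g3): the layer-sequence currency is an4's and is
IMPORTED, not re-typed; this file adds ONLY the run-indexed reading, the seven-pin record junction and the K2′-stub currency.  STATUS OF RECORD: N26 = binder B4 is
DEPENDENT on (D4) and VACATED in the discharge form of record (closes WITH B3 = N25, NODE O); the (D4)-chain instance for Bałaban's objects is 0∕1.

WHAT IS HERE (0 `def`, 0 `sorry`; compositions BY NAME):
* §1 AT A STAGE-12 TUPLE `θ` WITH ITS RUN-INDEXED LAYERS `lam13 : B12.RunParams → ResidB13 θ.toStage3Params`, READ ALONG RUN SEQUENCES `Ps k v : ℕ → B12.RunParams`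
  (per scale `k` and history `v`) whose layers' coarse tori grow without bound ([I] (1.21) «T^{(j+1)} ↗ ℤ^d»), with N10's [B13] leaf `B13LeafOfRecord θ₃ (lam13 P)`, the
  restriction sentence and the p. 15 ∕ (2.13) laws AT EVERY RUN, common constants of record along the sequences, and the (4.4) seams ∕ (190) data ∕ (1.7) data on
  those layers: `exists_chainTFac190H_view_of_runLayers` (the instance at the view's split `oneLoopSplitOfRecord₁₁ (θ.toStage11 F N p)`, leaf kernels and tori exposed),
  `leaves_W_view_of_runLayers` (dag-ref-D's WATCH-D4-TORUS-SEQUENCE handle AT THE RECORD: the chain's one-step data ARE THE RECORD's OWN STEPS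
  `(WtOfRecord θ₃ (lam13 (Ps k v m))).toTorusStep`, `rfl`), `atSlopeCont_view_of_runLayers`, `n26_datumOfRecord₁₂_of_runLayers`, `endpoint_and_n26_datumOfRecord₁₂_of_runLayers`,
  and **`d4AtSlopeOfD1Record12_at_of_runLayers`** — the registered stub `stub_d4AtSlopeCont12 : D4AtSlopeOfD1Record12` of crux K2′ `EndpointGivenBR12` (plan g64,
  `D64-REV15/K2Skeleton12.lean` 796556caff13e573) AT THE TUPLE θ, in the stub's own letters (`AtSlopeCont (oneLoopSplit_betaOfMerged (betaMerged F ℰ_θ θ.ρ8 θ.bV)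
  (beta0OfMerged … θ.v₀) θ.γ) γ₀ (stepBal Nc Lc)` on a box `0 < γ₀ ≤ θ.γ`), FROM the run-layer list + the (1.22) identification + N1–N3 + the one-loop slope + (C-pt).
* §2 AT A SEVEN-PIN STAGE-12 RECORD `(D, w)`: `h238_of_isRecordOfRecord₁₂CB10YZWB8B12B13` — N10's OWN leaf `∀ P, (leavesP w P).b13` ⟹ the (D4) wall's (2.38) leaf
  `B13.Bound238With` for the record's OWN two-scale torus steps `WtOfRecord θ₃ (lam13 P)`, one member per run, at ℓ = ½·w.L (the N10 → (D4) → N26 junction AT THE RECORD);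
  `n26_of_isRecordOfRecord₁₂CB10YZWB8B12B13_of_b13` and `endpoint_and_n26_of_isRecordOfRecord₁₂CB10YZWB8B12B13_of_b13` — the N26 literal (resp. N25's END ∧ N26) at `(D, w)` ⇐
  N10's leaf at every run + per presentation the rows-(D4) ∧ B4 residue (resp. the (D1) ∧ (D4) ∧ B4 package) GIVEN those leaves — §1 says what that residue costs.

HONEST FRAMING.  Nothing of Bałaban's is constructed; no estimate is proved.  EVERY run sequence, law, seam, (190) datum, (1.7) datum, the (1.22) identification in the
record's letters, the one-loop slope and (C-pt) is a displayed HYPOTHESIS on the record's RESIDUAL [B13] objects; the junk-layer honesty pair of `Node00.Record12CarriersB13`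
§3 ∕ §5 applies verbatim (a layer with EMPTY spaces satisfies N10's leaf vacuously, and then `hemb` forces empty α₂-balls in the seam spaces — contentfulness = def-T's
term tower OF RECORD identifying the layers with the record's expansion, NOT in the tree).  (D4) INSTANCE 0∕1, D4 DISCHARGE NO DATE; `stub_d4AtSlopeCont12` NOT proved
(§1 is a REDUCTION of its body at θ to displayed inputs, not a discharge); N10 ∕ N25 ∕ N26 NOT discharged; record-level forms NOT-A-DISCHARGE under the INHABITED-AT
guard (K0′); counts unmoved.  WATCH-N26-LIMIT-JUNK (dag-ref-D READ #106, inherited, NODE-O-side): the merged β and `β⁰` of record are `limUnder` readings — where the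
(1.21) limit exists NOWHERE on a box they are history-constant and B4 holds BY JUNK; content comes only with the (1.22) identification `hm` (the chain's `beta1_eq`), a
displayed hypothesis here.  One finite four-torus programme at fixed ε per run — NOT the continuum limit, NOT ℝ⁴, NOT infinite volume, NOT OS, NOT a mass gap, NOT Clay.
Sources (context): [I] = [Balaban1987RG1] CMP **109** (1987): Thm 2 p. 259, (1.7) p. 261, (1.20)–(1.22) p. 264, (2.12)–(2.13) p. 268, (4.4) p. 281, (5.10) p. 293;
[II] = [Balaban1988RG2Cluster] CMP **116** (1988): (2.13) p. 14, p. 15, Lemma 3 (2.38) p. 20, p. 21; [15] = [Balaban1985Variational] CMP **102** (1985): (190) p. 308.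
-/

noncomputable section

open scoped Matrix.Norms.L2Operator

namespace Summit.QuantumFields.YangMills.Theorems.BalabanUVNodesN26AtRecord12B13RunLayers

open Literature.MathematicalPhysics.QuantumFieldTheory.Balaban1983to89
open Literature.MathematicalPhysics.QuantumFieldTheory.Balaban1983to89.FlowStep
open Literature.MathematicalPhysics.QuantumFieldTheory.Balaban1983to89.DagBinding (EndpointExistence WorldP leavesP)
open Literature.MathematicalPhysics.QuantumFieldTheory.Balaban1983to89.T4Continuum (T4Family FiniteEpsData)
open Literature.MathematicalPhysics.QuantumFieldTheory.Balaban1983to89.Node00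
open Literature.MathematicalPhysics.QuantumFieldTheory.Balaban1983to89.B13ScaleTransfer (Pt)
open Literature.MathematicalPhysics.QuantumFieldTheory.Balaban1983to89.TreeLengthTorus (TDom proj)
open Literature.MathematicalPhysics.QuantumFieldTheory.Balaban1983to89.B12Decay510 (mixedDeriv)
open Literature.MathematicalPhysics.QuantumFieldTheory.Balaban1983to89.Beta.RemainderChainLattice
open Literature.MathematicalPhysics.QuantumFieldTheory.Balaban1983to89.Beta.RemainderLimitTorus (LDom limKernel tproj)
open Literature.MathematicalPhysics.QuantumFieldTheory.Balaban1983to89.Beta.RemainderDecay190 (Consts190 Data190)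
open Literature.MathematicalPhysics.QuantumFieldTheory.Balaban1983to89.Beta.RemainderDecay190HoloChain (ChainTFac190H)
open Literature.MathematicalPhysics.QuantumFieldTheory.Balaban1983to89.Beta.RemainderWOfRecordB13
open Literature.MathematicalPhysics.QuantumFieldTheory.Balaban1983to89.Beta.OneStepKernelFamily (TbalOf)
open Literature.MathematicalPhysics.QuantumFieldTheory.Balaban1983to89.Beta.OneStepResolventKernel (JetData)
open Summit.QuantumFields.BalabanUV.Gaps
open Summit.QuantumFields.BalabanUV.Gaps.BetaContFromD4Chain
open Summit.QuantumFields.YangMills.Theorems.BalabanUVNodesN26AtBetaOfRecord11B13Layers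
open Summit.QuantumFields.YangMills.Theorems.BalabanUVNodesN26AtRecord12
open Metric Filter Topology

variable (F : T4Family) (N : ℕ) [NeZero N]

/-! ## §1 At a Stage-12 tuple with its run-indexed [B13] layers, read along run sequences; N10's leaf at every run; K2′'s stub at θ -/

section RunLayers

variable {γ₀ : ℝ} {M : ℕ} [NeZero M] {μ ν : Fin 4} {c : B13.Consts} {α₂ : ℝ} {q : Consts190}
variable (θ : Stage12Params F N) (p : B12.RunParams) (lam13 : B12.RunParams → ResidB13 θ.toStage3Params) (hle : γ₀ ≤ θ.γ)
  -- the leaf kernels and the (1.22) identification in the record's letters at the view (any run `p`; the view's Stage-9 part IS θ's)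
  (A1 : (k : ℕ) → (Fin (k + 1) → ℝ) → LDom 4 → Pt 4 → ℝ)
  (hm : ∀ k (v : Fin (k + 1) → ℝ), v ∈ Box γ₀ k →
    betaMergedOfRecord₁₁ F N (θ.toStage11 F N p) k v =
      beta0OfRecord₁₁ F N (θ.toStage11 F N p) k + B12Beta.secondMoment (fun _ _ => limKernel (A1 k v)) μ ν)
  -- AT EVERY RUN: the p. 15 ∕ (2.13) laws of the record's layer, N10's [B13] leaf at it, its restriction sentence
  (hsp : ∀ P, SpLaw (lam13 P)) (h213 : ∀ P, Law213 (lam13 P))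
  (hleaf : ∀ P, B13LeafOfRecord θ.toStage3Params (lam13 P)) (hR : ∀ P, (lam13 P).Restr)
  (hC : CondsL 4 c ((c.L : ℝ) / 2)) (hs : SignsL c α₂ q.B₃)
  -- per (scale, history): a RUN SEQUENCE through the record's layers with growing coarse tori, at common constants of record
  (Ps : (k : ℕ) → (Fin (k + 1) → ℝ) → ℕ → B12.RunParams)
  (hn : ∀ k v, Tendsto (fun m => (lam13 (Ps k v m)).n) atTop atTop)
  (hc : ∀ k v m, c13OfRecord θ.toStage3Params (lam13 (Ps k v m)) = c)
  -- the (4.4) seams into the record layers' spaces p. 15, with the layers' ACTIVITIES holomorphic along them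
  (Wn : (k : ℕ) → (Fin (k + 1) → ℝ) → ℕ → Type) (instW : ∀ k v m, NormedAddCommGroup (Wn k v m))
  (instWs : ∀ k v m, NormedSpace ℂ (Wn k v m))
  (emb : (k : ℕ) → (v : Fin (k + 1) → ℝ) → (m : ℕ) → TDom 4 ((lam13 (Ps k v m)).n + 1) → Wn k v m → (lam13 (Ps k v m)).Φ)
  (hemb : ∀ k v m X, ∀ u ∈ ball (0 : Wn k v m) α₂, emb k v m X u ∈ (lam13 (Ps k v m)).sp2 X)
  (hH : ∀ k v m (X Z : TDom 4 ((lam13 (Ps k v m)).n + 1)), Z.1 ⊆ X.1 →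
    DifferentiableOn ℂ (fun u => (lam13 (Ps k v m)).H Z (emb k v m X u)) (ball 0 α₂))
  -- the (190)-side data on the record layers' tori and the (1.7) ∕ test-vector-limit data with the read-out of the leaf kernels
  (D : (k : ℕ) → (v : Fin (k + 1) → ℝ) → Data190 4 M (NOfLayers fun m => lam13 (Ps k v m)) (Wn k v) q)
  (V : (k : ℕ) → (Fin (k + 1) → ℝ) → LDom 4 → Type) (instV : ∀ k v Y, NormedAddCommGroup (V k v Y))
  (instVs : ∀ k v Y, NormedSpace ℂ (V k v Y))
  (Fw : (k : ℕ) → (v : Fin (k + 1) → ℝ) → (Y : LDom 4) → V k v Y → ℂ)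
  (hFd : ∀ k v Y, ∃ ρ > 0, DifferentiableOn ℂ (Fw k v Y) (ball 0 ρ))
  (r : (k : ℕ) → (v : Fin (k + 1) → ℝ) → (m : ℕ) → (Y : LDom 4) → Wn k v m →L[ℂ] V k v Y)
  (hfac : ∀ k v (Y : LDom 4), ∀ᶠ m in atTop, ∀ u ∈ ball (0 : Wn k v m) α₂,
    (lam13 (Ps k v m)).Ek1 (tproj ((lam13 (Ps k v m)).n + 1) Y) (emb k v m (tproj ((lam13 (Ps k v m)).n + 1) Y) u) =
      Fw k v Y (r k v m Y u))
  (t : (k : ℕ) → (v : Fin (k + 1) → ℝ) → (Y : LDom 4) → Pt 4 → V k v Y)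
  (hconv : ∀ k v (Y : LDom 4) (x : Pt 4),
    Tendsto (fun m => r k v m Y ((D k v).hn m (tproj ((lam13 (Ps k v m)).n + 1) Y) (proj (((lam13 (Ps k v m)).n + 1) * M) x)))
      atTop (𝓝 (t k v Y x)))
  (ha : ∀ k v (Y : LDom 4) (z : Pt 4), A1 k v Y z = (mixedDeriv (Fw k v Y) (t k v Y 0) (t k v Y z)).re)

include hle hm hsp h213 hleaf hR hC hs hn hc instW instWs hemb hH hFd hfac hconv ha

/-- **THE (D4)-CHAIN INSTANCE AT THE STAGE-12 VIEW's SPLIT FROM THE RECORD's OWN RUN-INDEXED [B13] LAYERS** (an4's `chainTFac190H_ofB13Layers` at the view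
`θ.toStage11 F N p` with the layer sequences `m ↦ lam13 (Ps k v m)` — ONE LINE over the row-(D4) owner's object): leaf kernels `A1` with the (1.22) identification at
the view on a box `γ₀ ≤ θ.γ`; AT EVERY RUN the laws, N10's [B13] leaf `B13LeafOfRecord θ₃ (lam13 P)` and the restriction sentence; PER (k, v) a run sequence `Ps k v`
whose record layers' coarse tori grow without bound ([I] (1.21)) at common constants of record, with the (4.4) seams ∕ (190) data ∕ (1.7) data on those layers ⟹
`∃ R : ChainTFac190H 4 M μ ν (oneLoopSplitOfRecord₁₁ F N (θ.toStage11 F N p)) γ₀ c (L∕2) α₂ q` with `R.A1 = A1` AND tori `(R.leaves k v hv).N = m ↦ (lam13 (Ps k v m)).n + 1`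
(dag-ref-D's WATCH-D4-TORUS-SEQUENCE handle: the tori are the RECORD LAYERS' along the run sequence, `hn` a displayed binder).  Instance 0∕1.
[cite: Balaban1987RG1, (1.7) p.261, (1.21)-(1.22) p.264 and (4.4) p.281; Balaban1988RG2Cluster, (2.13) p.14, p.15, Lemma 3 (2.38) p.20 and p.21; Balaban1985Variational, (190) p.308] -/
theorem exists_chainTFac190H_view_of_runLayers :
    ∃ R : ChainTFac190H 4 M μ ν (oneLoopSplitOfRecord₁₁ F N (θ.toStage11 F N p)) γ₀ c ((c.L : ℝ) / 2) α₂ q,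
      R.A1 = A1 ∧ ∀ k (v : Fin (k + 1) → ℝ) (hv : v ∈ B12Beta.HistBox γ₀ k),
        (R.leaves k v hv).N = fun m => (lam13 (Ps k v m)).n + 1 :=
  ⟨chainTFac190H_ofB13Layers F N (θ.toStage11 F N p) hle A1 hm (fun k v m => lam13 (Ps k v m)) hn hc
      (fun k v m => hsp (Ps k v m)) (fun k v m => h213 (Ps k v m)) (fun k v m => hleaf (Ps k v m))
      (fun k v m => hR (Ps k v m)) hC hs Wn instW instWs emb hemb hH D V instV instVs Fw hFd r hfac t hconv ha,
    rfl, fun _ _ _ => rfl⟩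

/-- **WATCH-D4-TORUS-SEQUENCE handle AT THE RECORD (steps)**: the (k, v)-leaf list of an4's chain over the run-indexed layers has one-step data
`W m = (WtOfRecord θ.toStage3Params (lam13 (Ps k v m))).toTorusStep` — THE RECORD's OWN two-scale torus steps of the runs `Ps k v m` (`rfl`;
`chainTFac190H_ofB13Layers_leaves_W` at the view). [cite: Balaban1987RG1, (1.21) p.264; Balaban1988RG2Cluster, (1.1)-(2.13) pp.3-14 (carrier)] -/
theorem leaves_W_view_of_runLayers (k : ℕ) (v : Fin (k + 1) → ℝ) (hv : v ∈ B12Beta.HistBox γ₀ k) :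
    ((chainTFac190H_ofB13Layers F N (θ.toStage11 F N p) hle A1 hm (fun k v m => lam13 (Ps k v m)) hn hc
      (fun k v m => hsp (Ps k v m)) (fun k v m => h213 (Ps k v m)) (fun k v m => hleaf (Ps k v m))
      (fun k v m => hR (Ps k v m)) hC hs Wn instW instWs emb hemb hH D V instV instVs Fw hFd r hfac t hconv ha).leaves k v hv).W =
      fun m => (WtOfRecord θ.toStage3Params (lam13 (Ps k v m))).toTorusStep :=
  rfl

/-- **THE ROWS-(D4) ∧ B4 RESIDUE AT THE VIEW's SPLIT FROM THE RECORD's RUN-INDEXED [B13] LAYERS**: the run-layer list, the (1.22) identification at the view, N1–N3 at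
ℓ = ½L (`CondsL`, `R22gen (L∕2)`, `Valid`, `SignsL`), smallness `ε₁·K_rem,L ≤ s` and (C-pt) on the leaf kernels ⟹
`AtSlopeCont (oneLoopSplitOfRecord₁₁ F N (θ.toStage11 F N p)) γ₀ s` (an4's `atSlopeCont_oneLoopSplitOfRecord₁₁_of_b13Layers` at the view) — EVERY split of the Stage-12
datum's β IS this one (p461633 `oneLoopSplit_datumOfRecord₁₂_eq_view`), so this is the residue the Stage-12 record consumers (§2, p461633 §2 ∕ §4) ask per presentation.
Instance 0∕1. [cite: Balaban1988RG2Cluster, p.15, Lemma 3 (2.38) p.20 and p.21; Balaban1987RG1, (1.7) p.261, (1.20)-(1.22) p.264, (4.4) p.281 and (5.10) p.293; Balaban1985Variational, (190) p.308] -/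
theorem atSlopeCont_view_of_runLayers (h22 : c.R22gen ((c.L : ℝ) / 2)) (hq : q.Valid c.δ₀) {s : ℝ}
    (hsmall : c.ε₁ * remCoeffL 4 M c α₂ q.B₃ ≤ s)
    (hcpt : ∀ k (x : Pt 4), ContinuousOn (fun v : Fin (k + 1) → ℝ => limKernel (A1 k v) x) (Box γ₀ k)) :
    AtSlopeCont (oneLoopSplitOfRecord₁₁ F N (θ.toStage11 F N p)) γ₀ s :=
  atSlopeCont_oneLoopSplitOfRecord₁₁_of_b13Layers F N (θ.toStage11 F N p) hle A1 hm (fun k v m => lam13 (Ps k v m)) hn hc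
    (fun k v m => hsp (Ps k v m)) (fun k v m => h213 (Ps k v m)) (fun k v m => hleaf (Ps k v m))
    (fun k v m => hR (Ps k v m)) hC hs Wn instW instWs emb hemb hH D V instV instVs Fw hFd r hfac t hconv ha h22 hq hsmall hcpt

/-- **N26 AT THE STAGE-12 DATUM FROM THE RECORD's RUN-INDEXED [B13] LAYERS + N10's LEAVES** (provisos `hP`; an4's `n26_datumOfRecord₁₂_of_b13Layers_view` along run
sequences): the run-layer list, the (1.22) identification at the view, N1–N3 at ℓ = ½L and (C-pt), on a box `0 < γ₀ ≤ θ.γ` ⟹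
`∃ γc > 0, BetaContH γc (datumOfRecord₁₂ F N θ hP).βfun`.  Instance 0∕1; N26 NOT discharged.
[cite: Balaban1987RG1, (1.7) p.261, (1.20)-(1.22) p.264, (4.4) p.281 and (5.10) p.293; Balaban1988RG2Cluster, p.15, Lemma 3 (2.38) p.20 and p.21; Balaban1985Variational, (190) p.308] -/
theorem n26_datumOfRecord₁₂_of_runLayers (hP : θ.Provisos₁₂ F N) (h22 : c.R22gen ((c.L : ℝ) / 2)) (hq : q.Valid c.δ₀)
    (hcpt : ∀ k (x : Pt 4), ContinuousOn (fun v : Fin (k + 1) → ℝ => limKernel (A1 k v) x) (Box γ₀ k)) (hγ₀ : 0 < γ₀) :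
    ∃ γc : ℝ, 0 < γc ∧ BetaContH γc (datumOfRecord₁₂ F N θ hP).βfun :=
  n26_datumOfRecord₁₂_of_b13Layers_view F N θ hP p hle A1 hm (fun k v m => lam13 (Ps k v m)) hn hc (fun k v m => hsp (Ps k v m))
    (fun k v m => h213 (Ps k v m)) (fun k v m => hleaf (Ps k v m)) (fun k v m => hR (Ps k v m)) hC h22 hq hs Wn instW instWs
    emb hemb hH D V instV instVs Fw hFd r hfac t hconv ha hcpt hγ₀

/-- **N25's END ∧ N26 AT THE STAGE-12 DATUM FROM THE RECORD's RUN-INDEXED [B13] LAYERS + N10's LEAVES + ROW (D1)'s RESIDUE** (an4's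
`endpoint_and_n26_datumOfRecord₁₂_of_b13Layers_view` along run sequences): row (D1)'s residue `Gaps.D1Residue.Residue Lc Js Nc μ' ν'` pinned on the view's one-loop
numbers of record (= the one-loop field of EVERY split of the datum's β, p461633 §0), the run-layer list, the (1.22) identification at the view, N1–N3 at ℓ = ½L, the
one-loop slope `ε₁·K_rem,L ≤ stepBal Nc Lc` and (C-pt), box `0 < γ₀ ≤ θ.γ` ⟹ `EndpointExistence D.C.toB12 ∧ ∃ γc > 0, BetaContH γc D.βfun` at
`D := datumOfRecord₁₂ F N θ hP`.  Instance 0∕1 on (D1) and (D4); N25 ∕ N26 NOT discharged. [cite: Balaban1987RG1, Thm 2 p.259 (first sentence), (1.7) p.261, (1.20)-(1.22) p.264 and (2.12)-(2.13) p.268; Balaban1988RG2Cluster, p.15, Lemma 3 (2.38) p.20 and p.21; Balaban1985Variational, (190) p.308] -/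
theorem endpoint_and_n26_datumOfRecord₁₂_of_runLayers (hP : θ.Provisos₁₂ F N) {Lc : ℕ} [NeZero Lc] (Js : ℕ → JetData 3 Lc)
    {Nc : ℝ} {μ' ν' : Fin 4} (hβ : ∀ j, beta0OfRecord₁₁ F N (θ.toStage11 F N p) j = B12Beta.secondMoment (TbalOf Lc Js j) μ' ν')
    (h1 : D1Residue.Residue Lc Js Nc μ' ν') (hγ₀ : 0 < γ₀) (h22 : c.R22gen ((c.L : ℝ) / 2)) (hq : q.Valid c.δ₀)
    (hsmall : c.ε₁ * remCoeffL 4 M c α₂ q.B₃ ≤ B12Normalization.stepBal Nc Lc)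
    (hcpt : ∀ k (x : Pt 4), ContinuousOn (fun v : Fin (k + 1) → ℝ => limKernel (A1 k v) x) (Box γ₀ k)) :
    EndpointExistence (datumOfRecord₁₂ F N θ hP).C.toB12 ∧
      ∃ γc : ℝ, 0 < γc ∧ BetaContH γc (datumOfRecord₁₂ F N θ hP).βfun :=
  endpoint_and_n26_datumOfRecord₁₂_of_b13Layers_view F N θ hP p hle A1 hm (fun k v m => lam13 (Ps k v m)) hn hc
    (fun k v m => hsp (Ps k v m)) (fun k v m => h213 (Ps k v m)) (fun k v m => hleaf (Ps k v m)) (fun k v m => hR (Ps k v m))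
    hC h22 hq hs Wn instW instWs emb hemb hH D V instV instVs Fw hFd r hfac t hconv ha hcpt Js hβ h1 hγ₀ hsmall

/-- **CRUX K2′'s REGISTERED STUB `stub_d4AtSlopeCont12 : D4AtSlopeOfD1Record12` AT THE TUPLE θ, IN THE STUB's OWN LETTERS, FROM THE RECORD's RUN-INDEXED [B13]
LAYERS** (plan g64 `D64-REV15/K2Skeleton12.lean`; the stub's body at `(F, θ)` reads, for every (D1) datum `(Lc, Js, Nc)` pinned on the record's one-loop numbers,
`∃ γ₀, 0 < γ₀ ∧ γ₀ ≤ θ.γ ∧ AtSlopeCont (oneLoopSplit_betaOfMerged (betaMerged F ℰ_θ θ.ρ8 θ.bV) (beta0OfMerged (betaMerged F ℰ_θ θ.ρ8 θ.bV) θ.v₀) θ.γ) γ₀ (stepBal Nc Lc)`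
with `ℰ_θ := mergedTermFamilyMatT F N (TcOfRecord F N) (chiFixed7 F N θ.ν) θ.εbg`): THAT conclusion, at the slope `stepBal Nc Lc` of any (D1) datum, ⇐ the run-layer
list of this section on a box `0 < γ₀ ≤ θ.γ` + the (1.22) identification at the view + N1–N3 at ℓ = ½L + the one-loop slope `ε₁·K_rem,L ≤ stepBal Nc Lc` + (C-pt) —
the stub's DEFINITIONAL split IS `oneLoopSplitOfRecord₁₁ F N (θ.toStage11 F N p)` (`rfl`), so this is `atSlopeCont_view_of_runLayers` re-read.  A REDUCTION of the stub
at θ to displayed inputs on the record's residual objects — NOT a proof of the stub (instance 0∕1; the (D1) pin and residue are not used by the β-remainder side).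
[cite: Balaban1988RG2Cluster, Lemma 3 (2.38) p.20 and p.21; Balaban1987RG1, (1.20)-(1.22) p.264, (2.12)-(2.13) p.268 and (5.10) p.293; Balaban1985Variational, (190) p.308] -/
theorem d4AtSlopeOfD1Record12_at_of_runLayers (hγ₀ : 0 < γ₀) (h22 : c.R22gen ((c.L : ℝ) / 2)) (hq : q.Valid c.δ₀) {Lc : ℕ}
    {Nc : ℝ} (hsmall : c.ε₁ * remCoeffL 4 M c α₂ q.B₃ ≤ B12Normalization.stepBal Nc Lc)
    (hcpt : ∀ k (x : Pt 4), ContinuousOn (fun v : Fin (k + 1) → ℝ => limKernel (A1 k v) x) (Box γ₀ k)) :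
    letI := θ.instVβ₁; letI := θ.instVβ₂; letI := θ.instιβ
    ∃ γ₁ : ℝ, 0 < γ₁ ∧ γ₁ ≤ θ.γ ∧
      AtSlopeCont
        (oneLoopSplit_betaOfMerged (betaMerged F (mergedTermFamilyMatT F N (TcOfRecord F N) (chiFixed7 F N θ.ν) θ.εbg) θ.ρ8 θ.bV)
          (beta0OfMerged (betaMerged F (mergedTermFamilyMatT F N (TcOfRecord F N) (chiFixed7 F N θ.ν) θ.εbg) θ.ρ8 θ.bV) θ.v₀) θ.γ)
        γ₁ (B12Normalization.stepBal Nc Lc) :=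
  ⟨γ₀, hγ₀, hle,
    atSlopeCont_view_of_runLayers F N θ p lam13 hle A1 hm hsp h213 hleaf hR hC hs Ps hn hc Wn instW instWs emb hemb hH D V instV
      instVs Fw hFd r hfac t hconv ha h22 hq hsmall hcpt⟩

end RunLayers

/-! ## §2 At a seven-pin Stage-12 record: N10's own leaf is the wall's Lemma-3 leaf for the record's own steps; N26 (and N25's END ∧ N26) from N10's leaf + the residue -/

section Record

variable {F N}
variable {D : FiniteEpsData F (Matrix.specialUnitaryGroup (Fin N) ℂ)} {w : WorldP}

/-- **THE N10 → (D4) → N26 JUNCTION AT A SEVEN-PIN STAGE-12 RECORD**: if `(D, w)` is the record with all seven carrier groups pinned and N10's OWN leaf holds at every run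
(`(leavesP w P).b13` — what N10 delivers at the record), then for the presenting tuple `θ` and ITS run-indexed [B13] layers `lam13` (exposed here), at every run the printed
[B13] triple `B13LeafOfRecord θ₃ (lam13 P)` holds, and WITH the layer's restriction sentence the (D4) wall's Lemma-3 leaf `B13.Bound238With` holds for the record's OWN two-scale
torus step `WtOfRecord θ₃ (lam13 P)` at the constants of record and the printed transfer factor ℓ = ½·w.L = ½L (row-(D4) owner's `bound238With_of_b13LeafOfRecord_L`) — ONE
member per run of the `h238` family that §1 ∕ an4's `chainTFac190H_ofB13Layers` consume along (1.21) sequences.  Bookkeeping; instance 0∕1. [cite: Balaban1988RG2Cluster, Lemma 3 (2.38) p.20; Balaban1987RG1, (1.21) p.264] -/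
theorem h238_of_isRecordOfRecord₁₂CB10YZWB8B12B13 (h : IsRecordOfRecord₁₂CB10YZWB8B12B13 F N D w) (hb13 : ∀ P : B12.RunParams, (leavesP w P).b13) :
    ∃ (θ : Stage12Params F N) (hP : θ.Provisos₁₂ F N) (lam13 : B12.RunParams → ResidB13 θ.toStage3Params),
      θ.Admissible F N ∧ D = datumOfRecord₁₂ F N θ hP ∧ w.L = (θ.L : ℝ) ∧
        ∀ P : B12.RunParams, B13LeafOfRecord θ.toStage3Params (lam13 P) ∧
          ((lam13 P).Restr → B13.Bound238With (WtOfRecord θ.toStage3Params (lam13 P)).toStepData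
            (c13OfRecord θ.toStage3Params (lam13 P)) (w.L / 2)) := by
  obtain ⟨θ, hP, lam13, lam12, lam8, Mstar, ops, ζ, lamW, hθ, hD, -, -, hL, hup⟩ := h
  have hleaf : ∀ P : B12.RunParams, B13LeafOfRecord θ.toStage3Params (lam13 P) := fun P => by
    have hb : (w.up P).b13 := hb13 P
    rw [hup P] at hb
    exact (upOfRecord₅CS_view₁₂B13B12B8B10YZW_b13_iff F N θ lam13 lam12 lam8 Mstar ops ζ lamW P).1 hb
  refine ⟨θ, hP, lam13, hθ, hD, hL, fun P => ⟨hleaf P, fun hR => ?_⟩⟩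
  rw [hL]
  exact bound238With_of_b13LeafOfRecord_L (hleaf P) hR

variable (F N) in
/-- **N26 AT A SEVEN-PIN STAGE-12 RECORD FROM N10's LEAF + THE RESIDUE GIVEN THAT LEAF**: if `(D, w)` is the seven-pin record, N10's own leaf holds at every run, and every
admissible presenting tuple `θ` (provisos `hP`, `D = datumOfRecord₁₂ θ hP`, `w.γ ≤ θ.γ`) with run-indexed [B13] layers SATISFYING N10's leaf at every run carries, at SOME split of
`D`'s β and SOME slope, the rows-(D4) ∧ B4 residue `AtSlopeCont Sβ w.γ s` (what §1's `atSlopeCont_view_of_runLayers` produces from those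
leaves + the remaining displayed inputs), then `∃ γc > 0, BetaContH γc D.βfun` (`γc := w.γ`; `Gaps.BetaContFromD4Chain.betaContH_of_atSlopeCont`).  ∀-over-presentations socket;
NOT-A-DISCHARGE (INHABITED-AT guard: the seven-pin record's inhabitation is K0′'s); instance 0∕1. [cite: Balaban1987RG1, (1.20)-(1.22) p.264 and (5.10) p.293; Balaban1988RG2Cluster, Lemma 3 (2.38) p.20; Balaban1989LargeFieldII, Thm 1 p.355 (the record)] -/
theorem n26_of_isRecordOfRecord₁₂CB10YZWB8B12B13_of_b13 (h : IsRecordOfRecord₁₂CB10YZWB8B12B13 F N D w)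
    (hb13 : ∀ P : B12.RunParams, (leavesP w P).b13)
    (hin : ∀ (θ : Stage12Params F N) (hP : θ.Provisos₁₂ F N) (lam13 : B12.RunParams → ResidB13 θ.toStage3Params),
      θ.Admissible F N → D = datumOfRecord₁₂ F N θ hP → w.γ ≤ θ.γ → (∀ P, B13LeafOfRecord θ.toStage3Params (lam13 P)) →
        ∃ (Sβ : B12Beta.OneLoopSplit D.βfun) (s : ℝ), AtSlopeCont Sβ w.γ s) :
    ∃ γc : ℝ, 0 < γc ∧ BetaContH γc D.βfun := by
  obtain ⟨θ, hP, lam13, lam12, lam8, Mstar, ops, ζ, lamW, hθ, hD, -, ⟨hγ0, hγle⟩, -, hup⟩ := h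
  have hleaf : ∀ P : B12.RunParams, B13LeafOfRecord θ.toStage3Params (lam13 P) := fun P => by
    have hb : (w.up P).b13 := hb13 P
    rw [hup P] at hb
    exact (upOfRecord₅CS_view₁₂B13B12B8B10YZW_b13_iff F N θ lam13 lam12 lam8 Mstar ops ζ lamW P).1 hb
  obtain ⟨Sβ, s, hs⟩ := hin θ hP lam13 hθ hD hγle hleaf
  exact ⟨w.γ, hγ0, betaContH_of_atSlopeCont hs⟩

variable (F N) in
/-- **N25's END ∧ N26 AT A SEVEN-PIN STAGE-12 RECORD FROM N10's LEAF + THE (D1) ∧ (D4) ∧ B4 PACKAGE GIVEN THAT LEAF**: as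
`n26_of_isRecordOfRecord₁₂CB10YZWB8B12B13_of_b13`, the per-presentation socket now delivering — GIVEN N10's leaf at every run of the presenting tuple's layers — a split `Sβ` of
`D`'s β, composite jets `Js` over a cube `Lc` with the (D1) pin `Sβ.β0 j = secondMoment (TbalOf Lc Js j) μ ν` and residue `Gaps.D1Residue.Residue Lc Js Nc μ ν`, and the
rows-(D4) ∧ B4 residue `AtSlopeCont Sβ w.γ (stepBal Nc Lc)` (§1's `endpoint_and_n26_datumOfRecord₁₂_of_runLayers` shape) ⟹ `EndpointExistence D.C.toB12 ∧ ∃ γc > 0, BetaContH γc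
D.βfun` (p461633's `endpoint_and_n26_datumOfRecord₁₂_of_residue_atSlopeCont` at the presenting tuple).  The β-side shape of crux K2′ read at a seven-pin record with N10's in-edge
consumed; NOT-A-DISCHARGE; instance 0∕1 on (D1) and (D4). [cite: Balaban1987RG1, Thm 2 p.259 (first sentence) and (1.20)-(1.22) p.264; Balaban1988RG2Cluster, Lemma 3 (2.38) p.20; Balaban1989LargeFieldII, Thm 1 p.355 (the record)] -/
theorem endpoint_and_n26_of_isRecordOfRecord₁₂CB10YZWB8B12B13_of_b13 (h : IsRecordOfRecord₁₂CB10YZWB8B12B13 F N D w)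
    (hb13 : ∀ P : B12.RunParams, (leavesP w P).b13)
    (hin : ∀ (θ : Stage12Params F N) (hP : θ.Provisos₁₂ F N) (lam13 : B12.RunParams → ResidB13 θ.toStage3Params),
      θ.Admissible F N → D = datumOfRecord₁₂ F N θ hP → w.γ ≤ θ.γ → (∀ P, B13LeafOfRecord θ.toStage3Params (lam13 P)) →
        ∃ (Sβ : B12Beta.OneLoopSplit D.βfun) (Lc : ℕ) (_ : NeZero Lc) (Js : ℕ → JetData 3 Lc) (Nc : ℝ) (μ ν : Fin 4),
          (∀ j, Sβ.β0 j = B12Beta.secondMoment (TbalOf Lc Js j) μ ν) ∧ D1Residue.Residue Lc Js Nc μ ν ∧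
            AtSlopeCont Sβ w.γ (B12Normalization.stepBal Nc Lc)) :
    EndpointExistence D.C.toB12 ∧ ∃ γc : ℝ, 0 < γc ∧ BetaContH γc D.βfun := by
  obtain ⟨θ, hP, lam13, lam12, lam8, Mstar, ops, ζ, lamW, hθ, hD, -, ⟨hγ0, hγle⟩, -, hup⟩ := h
  have hleaf : ∀ P : B12.RunParams, B13LeafOfRecord θ.toStage3Params (lam13 P) := fun P => by
    have hb : (w.up P).b13 := hb13 P
    rw [hup P] at hb
    exact (upOfRecord₅CS_view₁₂B13B12B8B10YZW_b13_iff F N θ lam13 lam12 lam8 Mstar ops ζ lamW P).1 hb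
  obtain ⟨Sβ, Lc, _, Js, Nc, μ, ν, hβ, h1, hres⟩ := hin θ hP lam13 hθ hD hγle hleaf
  subst hD
  exact endpoint_and_n26_datumOfRecord₁₂_of_residue_atSlopeCont F N θ hP Sβ Js hβ h1 hγ0 hres

end Record

/-! ## §3 (v1.1, dag-ref-D READ-117 repair) The junction PINNED TO THE RECORD's DISPLAYED [B13] layers: N10's leaf is load-bearing, by kernel

v1.0's §2 exposed `lam13` EXISTENTIALLY with no pin to `w.up` (so the tree's junk layer `CarriersB13.exists_residB13_b13LeafOfRecord` witnesses `h238_of_…`'s conclusion from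
the record ALONE) and let the socket `hin` range over ALL presentations (so it is instantiable at the junk layer, whose leaf holds vacuously): dag-ref-D g23's kernel probes
`RefDProbeP470063.h238_without_hb13` ∕ `n26_without_hb13` ∕ `endpoint_and_n26_without_hb13` — `hb13` decorative.  Repair (READ-117, verbatim): carry ALL SEVEN residuals and
the record's pin clause `∀ P, w.up P = upOfRecord₅CS F N (θ.view₁₂B13B12B8B10YZW F N lam13 lam12 lam8 Mstar ops ζ lamW) P` in `h238`'s ∃, and GUARD the socket by the same
pin.  Under the pin the displayed layer's printed triple IS N10's leaf run by run (`b13LeafOfRecord_iff_b13_of_up_eq`), so the pinned `h238` conclusion is EQUIVALENT to N10's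
leaf at the record (`b13_iff_h238_pinned_of_…`) and a pinned socket opens only with `hb13`.  §1–§2 above are byte-identical (append-only); contentfulness of the displayed
layer remains def-T's term tower OF RECORD (header) — this section repairs the TYPING of the record-level reading, nothing else; counts unmoved. -/

section RecordPinned

variable {F N}
variable {D : FiniteEpsData F (Matrix.specialUnitaryGroup (Fin N) ℂ)} {w : WorldP}

/-- **KERNEL CERTIFICATE — UNDER THE RECORD's PIN, THE DISPLAYED LAYER's PRINTED [B13] TRIPLE IS N10's LEAF, EVERY RUN** (v1.1, dag-ref-D READ-117): if the world's
upstream block is the S-binding at the seven-pin view of `(θ, lam13, lam12, lam8, Mstar, ops, ζ, lamW)` (the record's clause `∀ P, w.up P = upOfRecord₅CS … P`), then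
`B13LeafOfRecord θ₃ (lam13 P) ↔ (leavesP w P).b13` (`upOfRecord₅CS_view₁₂B13B12B8B10YZW_b13_iff`, `Iff.rfl` at the group of record, transported along the pin).  Consequence: a
socket GUARDED by the pin opens ONLY with N10's leaf `hb13` — the junk-layer instantiation of v1.0's unguarded socket is closed.  Bookkeeping.
[cite: Balaban1988RG2Cluster, Lemma 1 p.9, Lemma 2 p.11, Lemma 3 p.20 (the leaf at the objects of record)] -/
theorem b13LeafOfRecord_iff_b13_of_up_eq (θ : Stage12Params F N) (lam13 : B12.RunParams → ResidB13 θ.toStage3Params)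
    (lam12 : ResidB12 F N θ.τ9.M) (lam8 : ResidB8 θ.toStage3Params) (Mstar : ℕ) (ops : OpsY N θ.toStage3Params Mstar) (ζ : ResidZ F N)
    (lamW : ResidW F N) (hup : ∀ P, w.up P = upOfRecord₅CS F N (θ.view₁₂B13B12B8B10YZW F N lam13 lam12 lam8 Mstar ops ζ lamW) P)
    (P : B12.RunParams) : B13LeafOfRecord θ.toStage3Params (lam13 P) ↔ (leavesP w P).b13 := by
  show _ ↔ (w.up P).b13
  rw [hup P]
  exact (upOfRecord₅CS_view₁₂B13B12B8B10YZW_b13_iff F N θ lam13 lam12 lam8 Mstar ops ζ lamW P).symm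

/-- **THE N10 → (D4) → N26 JUNCTION PINNED TO THE RECORD** (v1.1 of `h238_of_isRecordOfRecord₁₂CB10YZWB8B12B13`, dag-ref-D READ-117's repair verbatim): at a seven-pin
Stage-12 record `(D, w)` with N10's OWN leaf at every run, the presenting tuple `θ` with ALL SEVEN residuals `(lam13, lam12, lam8, Mstar, ops, ζ, lamW)` is exposed TOGETHER
WITH THE PIN `∀ P, w.up P = upOfRecord₅CS F N (θ.view₁₂B13B12B8B10YZW F N lam13 lam12 lam8 Mstar ops ζ lamW) P` — so `lam13` IS the record's displayed [B13] layer, not SOME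
layer — and for THAT layer, at every run, the printed triple `B13LeafOfRecord θ₃ (lam13 P)` holds and, with the layer's restriction sentence, the (D4) wall's Lemma-3 leaf
`B13.Bound238With` holds for the record's OWN two-scale torus step `WtOfRecord θ₃ (lam13 P)` at the constants of record and ℓ = ½·w.L (row-(D4) owner's
`bound238With_of_b13LeafOfRecord_L`).  `hb13` IS load-bearing here (`b13_iff_h238_pinned_of_isRecordOfRecord₁₂CB10YZWB8B12B13`: the conclusion gives N10's leaf back).
Bookkeeping; instance 0∕1; contentfulness of the displayed layer = def-T's term tower of record, unchanged. [cite: Balaban1988RG2Cluster, Lemma 3 (2.38) p.20; Balaban1987RG1, (1.21) p.264] -/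
theorem h238_pinned_of_isRecordOfRecord₁₂CB10YZWB8B12B13 (h : IsRecordOfRecord₁₂CB10YZWB8B12B13 F N D w)
    (hb13 : ∀ P : B12.RunParams, (leavesP w P).b13) :
    ∃ (θ : Stage12Params F N) (hP : θ.Provisos₁₂ F N) (lam13 : B12.RunParams → ResidB13 θ.toStage3Params) (lam12 : ResidB12 F N θ.τ9.M)
      (lam8 : ResidB8 θ.toStage3Params) (Mstar : ℕ) (ops : OpsY N θ.toStage3Params Mstar) (ζ : ResidZ F N) (lamW : ResidW F N),
      θ.Admissible F N ∧ D = datumOfRecord₁₂ F N θ hP ∧ w.L = (θ.L : ℝ) ∧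
        (∀ P : B12.RunParams, w.up P = upOfRecord₅CS F N (θ.view₁₂B13B12B8B10YZW F N lam13 lam12 lam8 Mstar ops ζ lamW) P) ∧
        ∀ P : B12.RunParams, B13LeafOfRecord θ.toStage3Params (lam13 P) ∧
          ((lam13 P).Restr → B13.Bound238With (WtOfRecord θ.toStage3Params (lam13 P)).toStepData
            (c13OfRecord θ.toStage3Params (lam13 P)) (w.L / 2)) := by
  obtain ⟨θ, hP, lam13, lam12, lam8, Mstar, ops, ζ, lamW, hθ, hD, -, -, hL, hup⟩ := h
  have hleaf : ∀ P : B12.RunParams, B13LeafOfRecord θ.toStage3Params (lam13 P) := fun P =>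
    (b13LeafOfRecord_iff_b13_of_up_eq θ lam13 lam12 lam8 Mstar ops ζ lamW hup P).2 (hb13 P)
  refine ⟨θ, hP, lam13, lam12, lam8, Mstar, ops, ζ, lamW, hθ, hD, hL, hup, fun P => ⟨hleaf P, fun hR => ?_⟩⟩
  rw [hL]
  exact bound238With_of_b13LeafOfRecord_L (hleaf P) hR

/-- **`hb13` IS LOAD-BEARING IN THE PINNED JUNCTION (kernel)**: at a seven-pin Stage-12 record, N10's leaf at every run ⟺ the pinned `h238` conclusion (⇐: the pin clause
turns the displayed layer's printed triple back into `(leavesP w P).b13`, `b13LeafOfRecord_iff_b13_of_up_eq`).  Contrast v1.0's unpinned `h238_of_…`, whose conclusion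
follows from the record ALONE at EVERY record of the module (junk layer) — including node00-def-B13's honesty worlds `exists_isRecordOfRecord₁₂CB10YZWB8B12B13_forall_not_b13`
where N10's leaf FAILS at every run.  Bookkeeping. [cite: Balaban1988RG2Cluster, Lemma 3 (2.38) p.20 (bookkeeping at the objects of record)] -/
theorem b13_iff_h238_pinned_of_isRecordOfRecord₁₂CB10YZWB8B12B13 (h : IsRecordOfRecord₁₂CB10YZWB8B12B13 F N D w) :
    (∀ P : B12.RunParams, (leavesP w P).b13) ↔
      ∃ (θ : Stage12Params F N) (hP : θ.Provisos₁₂ F N) (lam13 : B12.RunParams → ResidB13 θ.toStage3Params) (lam12 : ResidB12 F N θ.τ9.M)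
        (lam8 : ResidB8 θ.toStage3Params) (Mstar : ℕ) (ops : OpsY N θ.toStage3Params Mstar) (ζ : ResidZ F N) (lamW : ResidW F N),
        θ.Admissible F N ∧ D = datumOfRecord₁₂ F N θ hP ∧ w.L = (θ.L : ℝ) ∧
          (∀ P : B12.RunParams, w.up P = upOfRecord₅CS F N (θ.view₁₂B13B12B8B10YZW F N lam13 lam12 lam8 Mstar ops ζ lamW) P) ∧
          ∀ P : B12.RunParams, B13LeafOfRecord θ.toStage3Params (lam13 P) ∧
            ((lam13 P).Restr → B13.Bound238With (WtOfRecord θ.toStage3Params (lam13 P)).toStepData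
              (c13OfRecord θ.toStage3Params (lam13 P)) (w.L / 2)) :=
  ⟨h238_pinned_of_isRecordOfRecord₁₂CB10YZWB8B12B13 h, fun ⟨θ, _, lam13, lam12, lam8, Mstar, ops, ζ, lamW, _, _, _, hup, hl⟩ P =>
    (b13LeafOfRecord_iff_b13_of_up_eq θ lam13 lam12 lam8 Mstar ops ζ lamW hup P).1 (hl P).1⟩

variable (F N) in
/-- **N26 AT A SEVEN-PIN STAGE-12 RECORD FROM N10's LEAF + THE RESIDUE GIVEN THAT LEAF — PINNED SOCKET** (v1.1 of `n26_of_isRecordOfRecord₁₂CB10YZWB8B12B13_of_b13`,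
dag-ref-D READ-117's repair): the per-presentation socket `hin` is GUARDED BY THE RECORD's PIN and ranges over the record's presenting tuples exactly — `θ` admissible with
provisos `hP`, ALL SEVEN residuals, `D = datumOfRecord₁₂ θ hP`, `w.C = D.C`, `0 < w.γ ≤ θ.γ`, `w.L = θ.L` and `∀ P, w.up P = upOfRecord₅CS F N (θ.view₁₂B13B12B8B10YZW …) P` —
and asks, GIVEN the printed [B13] triple of THOSE displayed layers at every run, for the rows-(D4) ∧ B4 residue `AtSlopeCont Sβ w.γ s` at some split of `D`'s β and some slope
(§1's `atSlopeCont_view_of_runLayers` says what that costs) ⟹ `∃ γc > 0, BetaContH γc D.βfun` (`γc := w.γ`; `Gaps.BetaContFromD4Chain.betaContH_of_atSlopeCont`).  By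
`b13LeafOfRecord_iff_b13_of_up_eq` the socket's leaf antecedent at any pinned tuple IS N10's leaf, so `hb13` is load-bearing (no junk-layer instantiation).
∀-over-pinned-presentations socket; NOT-A-DISCHARGE (INHABITED-AT guard: the record's inhabitation is K0′'s); instance 0∕1; N26 NOT discharged.
[cite: Balaban1987RG1, (1.20)-(1.22) p.264 and (5.10) p.293; Balaban1988RG2Cluster, Lemma 3 (2.38) p.20; Balaban1989LargeFieldII, Thm 1 p.355 (the record)] -/
theorem n26_of_isRecordOfRecord₁₂CB10YZWB8B12B13_of_b13_pinned (h : IsRecordOfRecord₁₂CB10YZWB8B12B13 F N D w)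
    (hb13 : ∀ P : B12.RunParams, (leavesP w P).b13)
    (hin : ∀ (θ : Stage12Params F N) (hP : θ.Provisos₁₂ F N) (lam13 : B12.RunParams → ResidB13 θ.toStage3Params) (lam12 : ResidB12 F N θ.τ9.M)
      (lam8 : ResidB8 θ.toStage3Params) (Mstar : ℕ) (ops : OpsY N θ.toStage3Params Mstar) (ζ : ResidZ F N) (lamW : ResidW F N),
      θ.Admissible F N → D = datumOfRecord₁₂ F N θ hP → w.C = D.C → 0 < w.γ → w.γ ≤ θ.γ → w.L = (θ.L : ℝ) →
        (∀ P : B12.RunParams, w.up P = upOfRecord₅CS F N (θ.view₁₂B13B12B8B10YZW F N lam13 lam12 lam8 Mstar ops ζ lamW) P) →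
        (∀ P, B13LeafOfRecord θ.toStage3Params (lam13 P)) →
          ∃ (Sβ : B12Beta.OneLoopSplit D.βfun) (s : ℝ), AtSlopeCont Sβ w.γ s) :
    ∃ γc : ℝ, 0 < γc ∧ BetaContH γc D.βfun := by
  obtain ⟨θ, hP, lam13, lam12, lam8, Mstar, ops, ζ, lamW, hθ, hD, hC, ⟨hγ0, hγle⟩, hL, hup⟩ := h
  obtain ⟨Sβ, s, hs⟩ := hin θ hP lam13 lam12 lam8 Mstar ops ζ lamW hθ hD hC hγ0 hγle hL hup fun P =>
    (b13LeafOfRecord_iff_b13_of_up_eq θ lam13 lam12 lam8 Mstar ops ζ lamW hup P).2 (hb13 P)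
  exact ⟨w.γ, hγ0, betaContH_of_atSlopeCont hs⟩

variable (F N) in
/-- **N25's END ∧ N26 AT A SEVEN-PIN STAGE-12 RECORD FROM N10's LEAF + THE (D1) ∧ (D4) ∧ B4 PACKAGE GIVEN THAT LEAF — PINNED SOCKET** (v1.1 of
`endpoint_and_n26_of_isRecordOfRecord₁₂CB10YZWB8B12B13_of_b13`, dag-ref-D READ-117's repair): as `n26_of_isRecordOfRecord₁₂CB10YZWB8B12B13_of_b13_pinned`, the pinned socket
now delivering — GIVEN the printed [B13] triple of the record's DISPLAYED layers at every run — a split `Sβ` of `D`'s β, composite jets `Js` over a cube `Lc` with the (D1) pin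
`Sβ.β0 j = secondMoment (TbalOf Lc Js j) μ ν` and residue `Gaps.D1Residue.Residue Lc Js Nc μ ν`, and the rows-(D4) ∧ B4 residue `AtSlopeCont Sβ w.γ (stepBal Nc Lc)` (§1's
`endpoint_and_n26_datumOfRecord₁₂_of_runLayers` shape) ⟹ `EndpointExistence D.C.toB12 ∧ ∃ γc > 0, BetaContH γc D.βfun` (p461633's
`endpoint_and_n26_datumOfRecord₁₂_of_residue_atSlopeCont` at the presenting tuple).  `hb13` load-bearing by `b13LeafOfRecord_iff_b13_of_up_eq`; the β-side shape of crux K2′ read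
at a seven-pin record with N10's in-edge consumed AT THE RECORD's OWN LAYERS; NOT-A-DISCHARGE; instance 0∕1 on (D1) and (D4).
[cite: Balaban1987RG1, Thm 2 p.259 (first sentence) and (1.20)-(1.22) p.264; Balaban1988RG2Cluster, Lemma 3 (2.38) p.20; Balaban1989LargeFieldII, Thm 1 p.355 (the record)] -/
theorem endpoint_and_n26_of_isRecordOfRecord₁₂CB10YZWB8B12B13_of_b13_pinned (h : IsRecordOfRecord₁₂CB10YZWB8B12B13 F N D w)
    (hb13 : ∀ P : B12.RunParams, (leavesP w P).b13)
    (hin : ∀ (θ : Stage12Params F N) (hP : θ.Provisos₁₂ F N) (lam13 : B12.RunParams → ResidB13 θ.toStage3Params) (lam12 : ResidB12 F N θ.τ9.M)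
      (lam8 : ResidB8 θ.toStage3Params) (Mstar : ℕ) (ops : OpsY N θ.toStage3Params Mstar) (ζ : ResidZ F N) (lamW : ResidW F N),
      θ.Admissible F N → D = datumOfRecord₁₂ F N θ hP → w.C = D.C → 0 < w.γ → w.γ ≤ θ.γ → w.L = (θ.L : ℝ) →
        (∀ P : B12.RunParams, w.up P = upOfRecord₅CS F N (θ.view₁₂B13B12B8B10YZW F N lam13 lam12 lam8 Mstar ops ζ lamW) P) →
        (∀ P, B13LeafOfRecord θ.toStage3Params (lam13 P)) →
          ∃ (Sβ : B12Beta.OneLoopSplit D.βfun) (Lc : ℕ) (_ : NeZero Lc) (Js : ℕ → JetData 3 Lc) (Nc : ℝ) (μ ν : Fin 4),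
            (∀ j, Sβ.β0 j = B12Beta.secondMoment (TbalOf Lc Js j) μ ν) ∧ D1Residue.Residue Lc Js Nc μ ν ∧
              AtSlopeCont Sβ w.γ (B12Normalization.stepBal Nc Lc)) :
    EndpointExistence D.C.toB12 ∧ ∃ γc : ℝ, 0 < γc ∧ BetaContH γc D.βfun := by
  obtain ⟨θ, hP, lam13, lam12, lam8, Mstar, ops, ζ, lamW, hθ, hD, hC, ⟨hγ0, hγle⟩, hL, hup⟩ := h
  obtain ⟨Sβ, Lc, _, Js, Nc, μ, ν, hβ, h1, hres⟩ := hin θ hP lam13 lam12 lam8 Mstar ops ζ lamW hθ hD hC hγ0 hγle hL hup fun P =>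
    (b13LeafOfRecord_iff_b13_of_up_eq θ lam13 lam12 lam8 Mstar ops ζ lamW hup P).2 (hb13 P)
  subst hD
  exact endpoint_and_n26_datumOfRecord₁₂_of_residue_atSlopeCont F N θ hP Sβ Js hβ h1 hγ0 hres

end RecordPinned

end Summit.QuantumFields.YangMills.Theorems.BalabanUVNodesN26AtRecord12B13RunLayers

end
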